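import Literature.MathematicalPhysics.QuantumFieldTheory.Balaban1983to89.B15Eq177GaugeInvariance
import Literature.MathematicalPhysics.QuantumFieldTheory.Balaban1983to89.B15Sect1InstancesB

/-!
# `Balaban1983to89.B15Eq177GaugeInvarianceB` — [Balaban1989LargeFieldI] (= [B15]) (1.77) p. 194 *"The function is invariant with respect to the group of all gauge transformations defined
# on Λ"* OVER A **BOND-LEVEL SOLUTION MAP** `bg : DetBackgroundB P G av` AND A **BOND DATUM** `𝔅 : BDetSet P` ∕ a bond-datum FAMILY `bd` — the print-datum parametrisation of
# `B15Eq177GaugeInvariance` §2–§3: the [15] (181) covariance hypothesis `Cov181B bg 𝔅 ū` of the solution map, and `bgKZB_gaugeAct ∕ fun177B_gaugeAct ∕ gaugeInvariant_fun177B ∕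
# isVLambdaB_gaugeAct` (+ the `std` family instances); the (b)-objects ARE the instance `(bg.toDetBackground, bondsDet 𝔹)` by `Iff.rfl`

statement-level skeleton of published theorems with citation tags; proofs where landed; nothing here is a claim about
the Yang–Mills mass gap

Cell `pub-ymgap` (HUMAN RULINGS D-0062 ∕ D-0149), lane `pub-ymgap-dag-n12-c` g34 (R134 seat (a), N12 = [B15], s1); `--kind definition --supports` K1⁹ `stmt-QuantumFields-27364`;
count-neutral.  (E1) variant (iii-b), N12 re-attachment step 3 of the lane's memo `N12-REATTACHMENT-DESIGN-2026-08-30.md` §3 (the input of the carrier instance's «minimal orbit» lemmas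
`B15Prop1Carrier.std_f_gaugeAct ∕ isMinimum_std_iff_forall`).  ONE definition (`Cov181B`, a located HYPOTHESIS shape, never asserted) + theorems whose proofs are the parent's verbatim.

HONESTY GUARD (director-ym №338 (5)).  PURELY ADDITIVE: print-datum parametrisation of `B15Eq177GaugeInvariance` §2 (`Cov181`) and §3 (`bgKZ_gaugeAct`, `fun177_gaugeAct`,
`gaugeInvariant_fun177`, `isVLambda_gaugeAct`) (FLAG №16 ∕ LOCATE-HSEAM 5d3298b8d191f169); the (b)-instances stay landed and true on their own text and remain the declarations of
record on SKELETON row B15.Eq1.77; NOTHING in the parent is edited; `Cov181 bg.toDetBackground 𝔹 ū ↔ Cov181B bg (bondsDet 𝔹) ū` is `Iff.rfl`.  §1 of the parent (`blockLift`,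
`qsstarGIter0_gaugeAct`, `blockIter_embIter`, `toMS_blockLift_self`) is datum-free and REUSED, not restated.

WHAT IS HERE.
* §1 `Cov181B bg 𝔅 ū` ([15] (181) for a bond-level solution map at a bond datum; the only field it reads is `bg.U 𝔅`) · `cov181_toDetBackground_iff` (`Iff.rfl`) · `Cov181B.apply_of_toMS_eq`
  (junction to r13's `eq125` binder, as in the parent).
* §2 over `(bg, 𝔅, Qs := qsstarGIter0 k)`: ★ `bgKZB_gaugeAct` (`U_{k,Z}(V_k^u) = U_{k,Z}(V_k)^{ū}`) · ★ `fun177B_gaugeAct` (`A(U_{k,Z}(V_k^u)) = A(U_{k,Z}(V_k))`) · `gaugeInvariant_fun177B` ·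
  `isVLambdaB_gaugeAct` (a minimiser of Prop. 1 stays one along its `Λ`-orbit) — proofs = the parent's chain `qsstarGIter0_gaugeAct` ∘ `B16Sect1Backgrounds.iter_gaugeAct` ∘ (181) ∘
  `B14Eq16FaddeevPopov.wilsonAction4_gaugeAct'`, verbatim.
* §3 the family instances (`B15Sect1InstancesB`): `fun177stdB_gaugeAct`, `gaugeInvariant_fun177stdB`, `isVLambdaStdB_gaugeAct` at `𝔅 := bd k (maxDomT M₁ Z)`.

HONEST SCOPE.  One hypothesis shape + covariance bookkeeping; (181) is NOT asserted (a displayed, located hypothesis, exactly as in the parent); nothing of Bałaban's analysis proved;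
count-neutral; N12 NOT discharged; K0⁷ ∕ K1⁹ NOT closed; the Yang–Mills mass gap (Clay) is NOT proved by any of this.  No `instance`, no `notation`, no `sorry`.

References: [B15] = [Balaban1989LargeFieldI] (1.74) p.192, (1.77)–(1.78) p.194; [15] = [Balaban1985Variational] (181) p.307; [LF-II] = [Balaban1989LargeFieldII] (1.25) p.362; [II] =
[Balaban1984PropagatorsII] (2.3) p.224; [I] = [Balaban1987RG1] (0.1) p.251; [III] = [Balaban1988Convergent] (2.12)–(2.13) pp.256–257.
-/

noncomputable section

namespace Literature.MathematicalPhysics.QuantumFieldTheory.Balaban1983to89.B15Eq177GaugeInvariance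

open Literature.MathematicalPhysics.QuantumFieldTheory.Balaban1983to89
open B15DeterminingSets B15DeterminingSetsB B14.Eq213DetSet B14.Eq216Concrete B14.Eq22Determines GaugeField
open Literature.MathematicalPhysics.QuantumFieldTheory.BalabanImbrieJaffe1984to88.BIJ85Eq453GaugeField
open Literature.MathematicalPhysics.QuantumFieldTheory.Balaban1983to89.B15Sect1Instances (fun177stdB IsVLambdaStdB)

variable {P : Params} {G : Type*} [GaugeGroup G]

/-! ## §1  [15] (181) for a bond-level solution map at a bond datum -/

/-- **[15] (181) p. 307 OVER `(bg : DetBackgroundB, 𝔅 : BDetSet)`**, verbatim: *"For the minimal configurations in the axial gauge we have U_k(V^v) = U_k(V)^{v̄}, (181) where v̄ is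
constant on blocks B^j(y), y ∈ Λ_j, and equal to v(y)"* — `B15Eq177GaugeInvariance.Cov181` with the site-level pair `(bg, 𝔹)` replaced by a bond-level solution map and datum: whenever
two multi-scale data agree up to `ū↾T^{(i)}` on every scale of the `Params` range, the minimal configurations `bg.U 𝔅 ·` differ by `ū`.  A HYPOTHESIS shape, NEVER asserted (the
mechanism is r08's `B11Eq181Covariance.minimiser_smul`; the datum records a minimiser, not its uniqueness).  The (b)-instance is `cov181_toDetBackground_iff` (`Iff.rfl`).
[cite: Balaban1985Variational, (181) p.307; Balaban1984PropagatorsII, (2.3) p.224; Balaban1987RG1, (0.1) p.251] -/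
def Cov181B {av : ∀ j, Averaging P j G} (bg : DetBackgroundB P G av) (𝔅 : BDetSet P) (ubar : GaugeTransf P 0 G) : Prop :=
  ∀ V V' : MSField P G, (∀ i, i ≤ P.m + P.K → V' i = gaugeAct (B16Sect1Backgrounds.toMS ubar i) (V i)) →
    bg.U 𝔅 V' = gaugeAct ubar (bg.U 𝔅 V)

/-- The instance of record: `Cov181` at the pulled-back site-level map IS `Cov181B` at the (b)-datum — `Iff.rfl` (F0a `DetBackgroundB.toDetBackground_U`).
[cite: Balaban1985Variational, (181) p.307; Balaban1987RG1, (0.1) p.251] -/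
theorem cov181_toDetBackground_iff {av : ∀ j, Averaging P j G} (bg : DetBackgroundB P G av) (𝔹 : DetSet P) (ubar : GaugeTransf P 0 G) :
    Cov181 bg.toDetBackground 𝔹 ubar ↔ Cov181B bg (bondsDet 𝔹) ubar := Iff.rfl

/-- JUNCTION to r13's `B16Sect1Backgrounds.eq125` binder (twin of `Cov181.apply_of_toMS_eq`): for any fine gauge transformation `u₀` agreeing with `ū` scale by scale in the `Params`
range, `U(𝔅, V^{u₀}) = U(𝔅, V)^{ū}`. [cite: Balaban1989LargeFieldII, (1.25) p.362; Balaban1985Variational, (181) p.307] -/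
theorem Cov181B.apply_of_toMS_eq {av : ∀ j, Averaging P j G} {bg : DetBackgroundB P G av} {𝔅 : BDetSet P} {ubar : GaugeTransf P 0 G} (h : Cov181B bg 𝔅 ubar)
    {u₀ : GaugeTransf P 0 G} (hc : ∀ i, i ≤ P.m + P.K → B16Sect1Backgrounds.toMS u₀ i = B16Sect1Backgrounds.toMS ubar i) (V : MSField P G) :
    bg.U 𝔅 (B16Sect1Backgrounds.msGaugeAct (B16Sect1Backgrounds.toMS u₀) V) = gaugeAct ubar (bg.U 𝔅 V) :=
  h V _ fun i hi => by rw [← hc i hi]; rfl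

/-! ## §2  (1.74) is gauge covariant and (1.77) gauge invariant over `(bg, 𝔅)`, given (181) at `𝔅` -/

section Eq177B

variable {av : ∀ j, Averaging P j G} (bg : DetBackgroundB P G av) (𝔅 : BDetSet P)

/-- **Covariance of (1.74) over `(bg, 𝔅)`**: `U_{k,Z}(V_k^u) = (U_{k,Z}(V_k))^{ū}` for `U_{k,Z}(V_k) = U(𝔅, M˙(Q_k^{s*}V_k))`, `k ≤ m + K` — the chain `Q_k^{s*}(V^u) = (Q_k^{s*}V)^{ū}`
(`qsstarGIter0_gaugeAct`) ∘ `M˙((·)^{ū}) = M˙(·)^{ū↾}` (`B16Sect1Backgrounds.iter_gaugeAct`) ∘ (181) (`Cov181B`, hypothesis); twin of `bgKZ_gaugeAct`.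
[cite: Balaban1989LargeFieldI, (1.74) p.192, (1.77) p.194; Balaban1985Variational, (181) p.307] -/
theorem bgKZB_gaugeAct {k : ℕ} (hk : k ≤ P.m + P.K) (u : GaugeTransf P k G) (h181 : Cov181B bg 𝔅 (blockLift k u)) (Vk : GaugeField P k G) :
    bgKZB bg 𝔅 (qsstarGIter0 k) (gaugeAct u Vk) = gaugeAct (blockLift k u) (bgKZB bg 𝔅 (qsstarGIter0 k) Vk) := by
  unfold bgKZB
  rw [qsstarGIter0_gaugeAct k hk u Vk]
  exact h181 _ _ fun i hi => B16Sect1Backgrounds.iter_gaugeAct av (blockLift k u) (qsstarGIter0 k Vk) i hi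

/-- **(1.77) p. 194 «The function is invariant with respect to the group of all gauge transformations defined on Λ», over `(bg, 𝔅)`** — for EVERY gauge transformation `u` of `T^{(k)}`
(`k ≤ m + K`), over (181) at `𝔅`: `A(U_{k,Z}(V_k^u)) = A(U_{k,Z}(V_k))`; twin of `fun177_gaugeAct`. [cite: Balaban1989LargeFieldI, (1.77) p.194; Balaban1985Variational, (181) p.307] -/
theorem fun177B_gaugeAct {k : ℕ} (hk : k ≤ P.m + P.K) (u : GaugeTransf P k G) (h181 : Cov181B bg 𝔅 (blockLift k u)) (Vk : GaugeField P k G) :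
    fun177B bg 𝔅 (qsstarGIter0 k) (gaugeAct u Vk) = fun177B bg 𝔅 (qsstarGIter0 k) Vk := by
  unfold fun177B
  rw [bgKZB_gaugeAct bg 𝔅 hk u h181 Vk, B14Eq16FaddeevPopov.wilsonAction4_gaugeAct']

/-- (1.77) over `(bg, 𝔅)` as `GaugeField.GaugeInvariant`, when (181) holds for every block-constant `ū`; twin of `gaugeInvariant_fun177`. [cite: Balaban1989LargeFieldI, (1.77) p.194] -/
theorem gaugeInvariant_fun177B {k : ℕ} (hk : k ≤ P.m + P.K) (h181 : ∀ u : GaugeTransf P k G, Cov181B bg 𝔅 (blockLift k u)) :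
    GaugeInvariant (fun177B bg 𝔅 (qsstarGIter0 k)) :=
  fun u Vk => fun177B_gaugeAct bg 𝔅 hk u (h181 u) Vk

/-- p. 194 *"We look for a minimal orbit"*, over `(bg, 𝔅)`: a minimiser `V_Λ` of (1.77) over the variables `V_k↾_Λ` stays a minimiser under every gauge transformation supported on `Λ`,
over (181); twin of `isVLambda_gaugeAct`. [cite: Balaban1989LargeFieldI, (1.77)–(1.78) p.194; Balaban1985Variational, (181) p.307] -/
theorem isVLambdaB_gaugeAct {Λ : Set (Site P 0)} {k : ℕ} (hk : k ≤ P.m + P.K) {u : GaugeTransf P k G} (hu : ∀ y, y ∉ pts k Λ → u y = 1)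
    (h181 : Cov181B bg 𝔅 (blockLift k u)) {Vout VΛ : GaugeField P k G} (hV : IsVLambdaB bg 𝔅 (qsstarGIter0 k) (bondsOf (pts k Λ)) Vout VΛ) :
    IsVLambdaB bg 𝔅 (qsstarGIter0 k) (bondsOf (pts k Λ)) Vout (gaugeAct u VΛ) := by
  refine ⟨fun b hb => ?_, fun W hW => ?_⟩
  · rw [gaugeAct_eq_of_not_mem hu VΛ hb]
    exact hV.1 b hb
  · rw [fun177B_gaugeAct bg 𝔅 hk u h181 VΛ]
    exact hV.2 W hW

end Eq177B

/-! ## §3  The family instances of `B15Sect1InstancesB` -/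

section StdB

variable {av : ∀ j, Averaging P j G} (bg : DetBackgroundB P G av) (M₁ : ℕ) (bd : ℕ → (ℕ → Set (Site P 0)) → BDetSet P)

/-- (1.77)'s gauge invariance at the family instance: `A(U_{k,Z}(V_k^u)) = A(U_{k,Z}(V_k))` for `fun177stdB bg M₁ bd Z k`, over (181) at `bd k (maxDomT M₁ Z)`.
[cite: Balaban1989LargeFieldI, (1.77) p.194; Balaban1985Variational, (181) p.307] -/
theorem fun177stdB_gaugeAct {Z : Set (Site P 0)} {k : ℕ} (hk : k ≤ P.m + P.K) (u : GaugeTransf P k G) (h181 : Cov181B bg (bd k (maxDomT M₁ Z)) (blockLift k u))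
    (Vk : GaugeField P k G) : fun177stdB bg M₁ bd Z k (gaugeAct u Vk) = fun177stdB bg M₁ bd Z k Vk :=
  fun177B_gaugeAct bg (bd k (maxDomT M₁ Z)) hk u h181 Vk

/-- (1.77) at the family instance as `GaugeField.GaugeInvariant`, over (181) for every block-constant `ū`. [cite: Balaban1989LargeFieldI, (1.77) p.194] -/
theorem gaugeInvariant_fun177stdB {Z : Set (Site P 0)} {k : ℕ} (hk : k ≤ P.m + P.K) (h181 : ∀ u : GaugeTransf P k G, Cov181B bg (bd k (maxDomT M₁ Z)) (blockLift k u)) :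
    GaugeInvariant (fun177stdB bg M₁ bd Z k) :=
  gaugeInvariant_fun177B bg (bd k (maxDomT M₁ Z)) hk h181

/-- A minimiser of Proposition 1 at the family instance stays one along its `Λ`-orbit, over (181). [cite: Balaban1989LargeFieldI, (1.77)–(1.78) p.194; Balaban1985Variational, (181) p.307] -/
theorem isVLambdaStdB_gaugeAct {Z Λ : Set (Site P 0)} {k : ℕ} (hk : k ≤ P.m + P.K) {u : GaugeTransf P k G} (hu : ∀ y, y ∉ pts k Λ → u y = 1)
    (h181 : Cov181B bg (bd k (maxDomT M₁ Z)) (blockLift k u)) {Vout VΛ : GaugeField P k G} (hV : IsVLambdaStdB bg M₁ bd Z Λ k Vout VΛ) :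
    IsVLambdaStdB bg M₁ bd Z Λ k Vout (gaugeAct u VΛ) :=
  isVLambdaB_gaugeAct bg (bd k (maxDomT M₁ Z)) hk hu h181 hV

end StdB

end Literature.MathematicalPhysics.QuantumFieldTheory.Balaban1983to89.B15Eq177GaugeInvariance

end
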